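import Summits.PneNP.PneNP.Theses.PhaseTwins
import Literature.Computability.Complexity.HardcoreInapproximability
import Literature.Computability.Complexity.KarpCliqueGadget

/-!
# Route PhaseTwins, crux `PseudorandomTwinsAbove` (stmt-PneNP-2721) — negative side: tightness of the picked line's targets (II)

Disprover's cycle 3, companion of `TargetsTight.lean` (self-contained; work file
`Summits/PneNP/PneNP/Cruxes/PseudorandomTwinsAbove/Disproof.lean`).

* `not_conflictGraphGapWithoutOccurrenceBound` — stub S4b (`stub_conflictGraphGap`) of the picked
  line `prg-image-exact-threshold-lift` with its occurrence hypothesis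
  `∀ v, (φ.countP fun cl => v ∈ cl.map Prod.fst) ≤ B` DROPPED is FALSE: the satisfiable E3-CNF
  `ψyes (8Δ-1)` (`x₀` occurring `8Δ` times) has a conflict graph of maximum degree `> Δ`
  (`le_maxDegree_ψyes`), so its code is off the promise of `hardcoreCount`, `N = 0`
  (`hardcoreCount_ψyes_eq_zero`) and `τ (8Δ) = 0`, while `ψno Δ` (`Δ` variable-disjoint copies of
  the complete sign pattern on three variables, `8Δ` clauses, `val ≤ 7/8`,
  `maxSatFraction_ψno_le`) would need `0 < N ≤ 0`. In the line the bound is supplied by S2a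
  (`stub_gapE3SATB`) and preserved by S2b (`stub_dupPad`, `max B 1`).
-/

set_option linter.dupNamespace false -- `Summit.PneNP.PneNP.…`: summit = sub-problem (D-0017)

namespace Summit.PneNP.PneNP.Theorems.PseudorandomTwinsAbove.Negative

open Literature.Computability.Complexity Literature.Probability.LatticeModels
open Finset

/-- The conflict graph of `φ` (verbatim the `fromRel` term of stubs S4a/S4b; a copy of
`conflictGraph` of `TargetsTight.lean`, kept local so that this file is self-contained).
[folklore] -/
abbrev occConflictGraph (φ : CNF ℕ) : SimpleGraph (Fin (KarpClique.annot 0 φ).length) :=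
  SimpleGraph.fromRel fun p q : Fin (KarpClique.annot 0 φ).length =>
    ((KarpClique.annot 0 φ)[p].1 = (KarpClique.annot 0 φ)[q].1 ∧
        (KarpClique.annot 0 φ)[p].2.1 ≠ (KarpClique.annot 0 φ)[q].2.1) ∨
    ((KarpClique.annot 0 φ)[p].2.1 = (KarpClique.annot 0 φ)[q].2.1 ∧
        (KarpClique.annot 0 φ)[p].2.2 ≠ (KarpClique.annot 0 φ)[q].2.2)

/-! ## A YES family with one variable of unbounded occurrence -/

/-- The `j`-th negative clause `(¬x₀ ∨ x_{3j+3} ∨ x_{3j+4})`. [this work] -/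
def negClause (j : ℕ) : Clause ℕ := [(0, false), (3 * j + 3, true), (3 * j + 4, true)]

/-- YES family: `(x₀ ∨ x₁ ∨ x₂)` followed by `k` clauses `(¬x₀ ∨ x_{3j+3} ∨ x_{3j+4})`, `j < k` — an
E3-CNF, satisfiable, in which `x₀` occurs `k + 1` times. [this work] -/
def ψyes (k : ℕ) : CNF ℕ := [(0, true), (1, true), (2, true)] :: (List.range k).map negClause

/-- `ψyes k` has `k + 1` clauses. [this work] -/
theorem length_ψyes (k : ℕ) : (ψyes k).length = k + 1 := by simp [ψyes]

/-- `ψyes k` is an E3-CNF. [this work] -/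
theorem isExactWidth_ψyes (k : ℕ) : (ψyes k).IsExactWidth 3 := by
  intro c hc
  simp only [ψyes, List.mem_cons, List.mem_map, List.mem_range] at hc
  rcases hc with rfl | ⟨j, -, rfl⟩
  · decide
  · refine ⟨rfl, ?_⟩
    simp [negClause]

/-- `ψyes k` is satisfiable: `x₀ := false`, everything else `true`. [this work] -/
theorem satisfiable_ψyes (k : ℕ) : (ψyes k).Satisfiable := by
  refine ⟨fun v => decide (v ≠ 0), (CNF.eval_eq_true_iff _ _).2 fun c hc => ?_⟩
  simp only [ψyes, List.mem_cons, List.mem_map, List.mem_range] at hc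
  rcases hc with rfl | ⟨j, -, rfl⟩
  · decide
  · simp [negClause, Clause.eval, Literal.eval]

/-- No clause of `ψyes k` is empty. [this work] -/
theorem ne_nil_of_mem_ψyes (k : ℕ) : ∀ c ∈ ψyes k, c ≠ [] := by
  intro c hc
  have h := (isExactWidth_ψyes k c hc).1
  rintro rfl
  simp at h

/-- Clause `j + 1` of `ψyes k` is `negClause j`. [this work] -/
theorem getElem_ψyes_succ (k j : ℕ) (hj : j + 1 < (ψyes k).length) :
    (ψyes k)[j + 1] = negClause j := by
  simp [ψyes]

/-- THE CONFLICT GRAPH OF `ψyes k` HAS MAXIMUM DEGREE `≥ k`: the occurrence of `x₀` in the first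
clause conflicts with the `k` occurrences of `¬x₀` (for any decidability instance). [this work] -/
theorem le_maxDegree_ψyes (k : ℕ) (inst : DecidableRel (occConflictGraph (ψyes k)).Adj) :
    k ≤ @SimpleGraph.maxDegree _ (occConflictGraph (ψyes k)) _ inst := by
  set A := KarpClique.annot 0 (ψyes k) with hA
  have hmem := KarpClique.mem_annot_iff 0 (ψyes k) (ne_nil_of_mem_ψyes k)
  -- the positive occurrence of `x₀` in clause 1
  obtain ⟨p₀, hp₀lt, hp₀⟩ : ∃ (p : ℕ) (h : p < A.length),
      A[p] = KarpClique.annLit (0 + 0 + 1) ((0, true) : Literal ℕ) :=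
    List.mem_iff_getElem.1 ((hmem _).2 ⟨0, by simp [length_ψyes], (0, true), by simp [ψyes], rfl⟩)
  -- the `k` negative occurrences
  have hq : ∀ j : Fin k, ∃ (q : ℕ) (h : q < A.length),
      A[q] = KarpClique.annLit (0 + (j.val + 1) + 1) ((0, false) : Literal ℕ) := by
    intro j
    refine List.mem_iff_getElem.1 ((hmem _).2 ⟨j.val + 1, by simp [length_ψyes], (0, false), ?_, rfl⟩)
    rw [getElem_ψyes_succ k j.val (by simp [length_ψyes])]
    simp [negClause]
  choose q hqlt hqA using hq
  let Q : Fin k → Fin A.length := fun j => ⟨q j, hqlt j⟩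
  have hQinj : Function.Injective Q := by
    intro j j' hjj'
    have e : q j = q j' := congrArg Fin.val hjj'
    have e2 := congrArg (fun p : ℕ => (A[p]?.map Prod.fst)) e
    simp only [List.getElem?_eq_getElem (hqlt j), List.getElem?_eq_getElem (hqlt j'), hqA,
      KarpClique.annLit, Option.map_some] at e2
    exact Fin.ext (by simpa using e2)
  let P : Fin A.length := ⟨p₀, hp₀lt⟩
  have hadj : ∀ j : Fin k, (occConflictGraph (ψyes k)).Adj P (Q j) := by
    intro j
    rw [SimpleGraph.fromRel_adj]
    have hP : A[P] = (1, Computability.encodeNat 0, true) := hp₀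
    have hQ : A[Q j] = (j.val + 2, Computability.encodeNat 0, false) := by
      simpa [KarpClique.annLit] using hqA j
    refine ⟨fun h => ?_, Or.inl (Or.inr ?_)⟩
    · have := congrArg (fun p : Fin A.length => (A[p]).1) h
      simp only [hP, hQ] at this
      omega
    · simp only [Fin.getElem_fin]
      rw [show A[(P : ℕ)] = A[P] from rfl, show A[(Q j : ℕ)] = A[Q j] from rfl, hP, hQ]
      simp
  calc k = (univ.image Q).card := by
        rw [card_image_of_injective _ hQinj, card_univ, Fintype.card_fin]
    _ ≤ ((occConflictGraph (ψyes k)).neighborFinset P).card := by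
        refine card_le_card fun w hw => ?_
        obtain ⟨j, -, rfl⟩ := mem_image.1 hw
        exact (SimpleGraph.mem_neighborFinset _ _ _).2 (hadj j)
    _ = (occConflictGraph (ψyes k)).degree P := SimpleGraph.card_neighborFinset_eq_degree _ _
    _ ≤ _ := SimpleGraph.degree_le_maxDegree _ _

/-- Hence the hard-core count of the code of the conflict graph of `ψyes k` VANISHES for every
`Δ < k` (the promise `maxDegree ≤ Δ` fails). [this work] -/
theorem hardcoreCount_ψyes_eq_zero (Δ p q k : ℕ) (hk : Δ < k) :
    hardcoreCount Δ p q
      (encodingGraph.encode ⟨(KarpClique.annot 0 (ψyes k)).length, occConflictGraph (ψyes k)⟩) = 0 :=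
  hardcoreCount_encode_of_lt_maxDegree Δ p q _ (hk.trans_le (le_maxDegree_ψyes k _))

/-! ## A NO family of any length `8r` -/

/-- All eight sign patterns on the variables `3i, 3i+1, 3i+2`. [this work] -/
def blockNo (i : ℕ) : CNF ℕ :=
  [[(3 * i, false), (3 * i + 1, false), (3 * i + 2, false)],
   [(3 * i, false), (3 * i + 1, false), (3 * i + 2, true)],
   [(3 * i, false), (3 * i + 1, true), (3 * i + 2, false)],
   [(3 * i, false), (3 * i + 1, true), (3 * i + 2, true)],
   [(3 * i, true), (3 * i + 1, false), (3 * i + 2, false)],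
   [(3 * i, true), (3 * i + 1, false), (3 * i + 2, true)],
   [(3 * i, true), (3 * i + 1, true), (3 * i + 2, false)],
   [(3 * i, true), (3 * i + 1, true), (3 * i + 2, true)]]

/-- NO family: `r` variable-disjoint blocks. [this work] -/
def ψno : ℕ → CNF ℕ
  | 0 => []
  | r + 1 => blockNo r ++ ψno r

/-- `ψno r` has `8r` clauses. [this work] -/
theorem length_ψno : ∀ r : ℕ, (ψno r).length = 8 * r
  | 0 => rfl
  | r + 1 => by
    rw [ψno, List.length_append, length_ψno r]
    simp [blockNo]
    omega

/-- Every block is an E3-CNF. [this work] -/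
theorem isExactWidth_blockNo (i : ℕ) : (blockNo i).IsExactWidth 3 := by
  intro c hc
  simp only [blockNo, List.mem_cons, List.not_mem_nil, or_false] at hc
  rcases hc with rfl | rfl | rfl | rfl | rfl | rfl | rfl | rfl <;>
    exact ⟨rfl, by simp⟩

/-- `ψno r` is an E3-CNF. [this work] -/
theorem isExactWidth_ψno : ∀ r : ℕ, (ψno r).IsExactWidth 3
  | 0 => fun c hc => by simp [ψno] at hc
  | r + 1 => fun c hc => by
    rw [ψno, List.mem_append] at hc
    rcases hc with hc | hc
    · exact isExactWidth_blockNo r c hc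
    · exact isExactWidth_ψno r c hc

/-- Every assignment satisfies exactly `7` clauses of a block. [this work] -/
theorem countP_blockNo (i : ℕ) (σ : ℕ → Bool) :
    ((blockNo i).countP fun c => Clause.eval σ c) = 7 := by
  cases h0 : σ (3 * i) <;> cases h1 : σ (3 * i + 1) <;> cases h2 : σ (3 * i + 2) <;>
    simp [blockNo, Clause.eval, Literal.eval, h0, h1, h2]

/-- Every assignment satisfies exactly `7r` clauses of `ψno r`. [this work] -/
theorem countP_ψno (σ : ℕ → Bool) : ∀ r : ℕ, ((ψno r).countP fun c => Clause.eval σ c) = 7 * r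
  | 0 => rfl
  | r + 1 => by
    rw [ψno, List.countP_append, countP_blockNo, countP_ψno σ r]
    ring

/-- `val(ψno r) ≤ 7/8` for `r ≥ 1`. [this work] -/
theorem maxSatFraction_ψno_le (r : ℕ) (hr : 0 < r) : (ψno r).maxSatFraction ≤ 7 / 8 := by
  classical
  unfold CNF.maxSatFraction
  refine Finset.sup'_le _ _ fun τ _ => ?_
  generalize (fun x => if h : x ∈ CNF.vars (ψno r) then τ ⟨x, h⟩ else false) = σ
  unfold CNF.satisfiedFraction CNF.numClauses
  rw [if_neg (by rw [length_ψno]; omega), countP_ψno, length_ψno]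
  have hr0 : (r : ℚ) ≠ 0 := by exact_mod_cast hr.ne'
  push_cast
  rw [mul_div_mul_right _ _ hr0]

/-! ## Target S4b without the occurrence bound is FALSE -/

/-- Stub S4b of the picked line with the occurrence hypothesis
`∀ v, (φ.countP fun cl => v ∈ cl.map Prod.fst) ≤ B` (and its now idle binder `B`) DROPPED.
Verbatim otherwise. [this work] -/
def ConflictGraphGapWithoutOccurrenceBound : Prop :=
  ∀ γ : ℚ, 0 < γ →
    ∃ (Δ p q : ℕ) (τ len : ℕ → ℕ), 3 ≤ Δ ∧ 0 < q ∧ hardCoreThreshold Δ < (p : ℝ) / q ∧ StrictMono len ∧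
      ∀ φ : CNF ℕ, φ.IsExactWidth 3 → 0 < φ.length → ∀ x : List Bool,
        x = encodingGraph.encode ⟨(KarpClique.annot 0 φ).length,
          SimpleGraph.fromRel fun p q : Fin (KarpClique.annot 0 φ).length =>
            ((KarpClique.annot 0 φ)[p].1 = (KarpClique.annot 0 φ)[q].1 ∧
                (KarpClique.annot 0 φ)[p].2.1 ≠ (KarpClique.annot 0 φ)[q].2.1) ∨
            ((KarpClique.annot 0 φ)[p].2.1 = (KarpClique.annot 0 φ)[q].2.1 ∧
                (KarpClique.annot 0 φ)[p].2.2 ≠ (KarpClique.annot 0 φ)[q].2.2)⟩ →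
        x.length = len φ.length ∧
        (φ.Satisfiable → 8 * τ φ.length ≤ hardcoreCount Δ p q x) ∧
        (φ.maxSatFraction ≤ 1 - γ → 0 < hardcoreCount Δ p q x ∧ hardcoreCount Δ p q x ≤ τ φ.length)

/-- THE OCCURRENCE BOUND OF TARGET S4b IS LOAD-BEARING. Without it, at `γ = 1/8` and whatever
`(Δ, p, q, τ)`: the satisfiable E3-CNF `ψyes (8Δ - 1)` (in which `x₀` occurs `8Δ` times) has a
conflict graph of maximum degree `≥ 8Δ - 1 > Δ`, so its code is OFF the promise and `N = 0`,
forcing `τ (8Δ) = 0`; but `ψno Δ` (`Δ` disjoint copies of the complete sign pattern, `8Δ` clauses,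
`val ≤ 7/8`) must then have `0 < N ≤ τ (8Δ) = 0`. (In the line the bound is supplied by S2a and
preserved by S2b.) [this work] -/
theorem not_occConflictGraphGapWithoutOccurrenceBound : ¬ ConflictGraphGapWithoutOccurrenceBound := by
  intro h
  obtain ⟨Δ, p, q, τ, len, hΔ, -, -, -, hall⟩ := h (1 / 8) (by norm_num)
  -- YES side: `ψyes (8Δ - 1)`, length `8Δ`, count `0`
  have hY := (hall (ψyes (8 * Δ - 1)) (isExactWidth_ψyes _) (by rw [length_ψyes]; omega) _ rfl).2.1
    (satisfiable_ψyes _)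
  rw [hardcoreCount_ψyes_eq_zero Δ p q (8 * Δ - 1) (by omega), length_ψyes,
    show 8 * Δ - 1 + 1 = 8 * Δ by omega] at hY
  -- NO side: `ψno Δ`, length `8Δ`
  have hN := (hall (ψno Δ) (isExactWidth_ψno Δ) (by rw [length_ψno]; omega) _ rfl).2.2
    ((maxSatFraction_ψno_le Δ (by omega)).trans (by norm_num))
  rw [length_ψno] at hN
  omega

end Summit.PneNP.PneNP.Theorems.PseudorandomTwinsAbove.Negative
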